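import Mathlib

/-!
# T5CoframeInvariance — the pointwise metric on 2-forms does not depend on the orthonormal coframe

Tier-5 support for sub-step N1 (Hodge-theoretic side; memo route/T5-N1-hodge-p6.md §H1–H2):
Voisin defines the pointwise metric on `k`-forms by declaring the wedges
`e^*_{i_1} ∧ ⋯ ∧ e^*_{i_k}` of an orthonormal coframe to be orthonormal [p0104 l. 7], and Lemma H2.1
computes in ONE such coframe (`dx_1, dy_1, dx_2, dy_2`; the six-coefficient model of
`T5HodgeStar`).  That the result is independent of the orthonormal coframe chosen is the statement
that the induced map `Λ²g` of an orthogonal `g ∈ O(4)` on `Λ²ℝ⁴ ≅ ℝ⁶` is again orthogonal — the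
Cauchy–Binet identity for `2 × 2` minors.  This file proves it explicitly for `4 × 4` matrices:

* `pairs`, `minor`, `compound`: the six index pairs `(i < j)` of `Fin 4` in the order of
  `T5HodgeStar`'s six coefficients, the `2 × 2` minor of `g` at a pair of rows and a pair of
  columns, and the `6 × 6` matrix `Λ²g` of minors;
* `minor_mul` / `compound_mul`: Cauchy–Binet, `Λ²(gh) = Λ²g · Λ²h` (a polynomial identity, checked
  entry by entry — 36 cases — by `ring`);
* `compound_one`, `compound_transpose`, `compound_orthogonal`: `Λ²(1) = 1`, `Λ²(gᵀ) = (Λ²g)ᵀ`, and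
  for `gᵀ g = 1` also `(Λ²g)ᵀ (Λ²g) = 1`;
* `dotProduct_compound_mulVec`: hence the standard inner product of coefficient vectors of
  2-forms is preserved under a change of orthonormal coframe — the metric `(,)_s` of Voisin (5.1)
  on `Λ²T^*_sS` (and its hermitian extension, `herm` of `T5HodgeStar`) is well defined.

Blind lane (cell pub-hodge-repro2): `import Mathlib` only, 0 sorry, standard axioms.
-/

namespace Summit.Ventures.HodgeRepro2.T5CoframeInvariance

open Matrix

/-- The six index pairs `i < j` of `Fin 4`, in the order `(0,1), (0,2), (0,3), (1,2), (1,3), (2,3)`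
of the six coefficients `dx₁∧dy₁, dx₁∧dx₂, dx₁∧dy₂, dy₁∧dx₂, dy₁∧dy₂, dx₂∧dy₂` of `T5HodgeStar`
(coframe order `dx₁, dy₁, dx₂, dy₂`). -/
def pairs : Fin 6 → Fin 4 × Fin 4 := ![(0, 1), (0, 2), (0, 3), (1, 2), (1, 3), (2, 3)]

/-- The `2 × 2` minor of `g` at the rows `pairs K` and the columns `pairs I`. -/
def minor (g : Matrix (Fin 4) (Fin 4) ℝ) (K I : Fin 6) : ℝ :=
  g (pairs K).1 (pairs I).1 * g (pairs K).2 (pairs I).2 -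
    g (pairs K).1 (pairs I).2 * g (pairs K).2 (pairs I).1

/-- The second compound matrix `Λ²g`: the `6 × 6` matrix of `2 × 2` minors of `g`, i.e. the matrix
of the induced map of `g` on `Λ²ℝ⁴` in the basis `e_{k₁} ∧ e_{k₂}`. -/
def compound (g : Matrix (Fin 4) (Fin 4) ℝ) : Matrix (Fin 6) (Fin 6) ℝ :=
  Matrix.of fun K I => minor g K I

/-- Entries of the compound matrix. -/
theorem compound_apply (g : Matrix (Fin 4) (Fin 4) ℝ) (K I : Fin 6) :
    compound g K I = minor g K I := rfl

/-- Cauchy–Binet for `2 × 2` minors of `4 × 4` matrices: a minor of a product is the sum over the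
six intermediate pairs of products of minors.  A polynomial identity, verified in each of the
36 positions. -/
theorem minor_mul (g h : Matrix (Fin 4) (Fin 4) ℝ) (K I : Fin 6) :
    minor (g * h) K I = ∑ J, minor g K J * minor h J I := by
  fin_cases K <;> fin_cases I <;>
    simp [minor, pairs, Matrix.mul_apply, Fin.sum_univ_four, Fin.sum_univ_six] <;> ring

/-- `Λ²(gh) = Λ²g · Λ²h`. -/
theorem compound_mul (g h : Matrix (Fin 4) (Fin 4) ℝ) :
    compound (g * h) = compound g * compound h := by
  ext K I
  rw [compound_apply, Matrix.mul_apply, minor_mul]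
  rfl

/-- `Λ²(1) = 1`. -/
theorem compound_one : compound (1 : Matrix (Fin 4) (Fin 4) ℝ) = 1 := by
  ext K I
  fin_cases K <;> fin_cases I <;> simp [compound, minor, pairs, Matrix.one_apply]

/-- `Λ²(gᵀ) = (Λ²g)ᵀ`. -/
theorem compound_transpose (g : Matrix (Fin 4) (Fin 4) ℝ) :
    compound gᵀ = (compound g)ᵀ := by
  ext K I
  simp only [compound, minor, Matrix.of_apply, Matrix.transpose_apply]
  ring

/-- For an orthogonal `g` (`gᵀ g = 1`) the compound `Λ²g` is orthogonal: `(Λ²g)ᵀ (Λ²g) = 1`. -/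
theorem compound_orthogonal {g : Matrix (Fin 4) (Fin 4) ℝ} (hg : gᵀ * g = 1) :
    (compound g)ᵀ * compound g = 1 := by
  rw [← compound_transpose, ← compound_mul, hg, compound_one]

/-- Also `(Λ²g) (Λ²g)ᵀ = 1` when `g gᵀ = 1`. -/
theorem compound_mul_transpose {g : Matrix (Fin 4) (Fin 4) ℝ} (hg : g * gᵀ = 1) :
    compound g * (compound g)ᵀ = 1 := by
  rw [← compound_transpose, ← compound_mul, hg, compound_one]

/-- The induced map on 2-forms of an orthogonal change of coframe preserves the standard inner
product of coefficient vectors: `⟪Λ²g x, Λ²g y⟫ = ⟪x, y⟫`.  So the metric on `Λ²T^*_sS` defined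
from ANY orthonormal coframe (Voisin p0104 l. 7) is the same. -/
theorem dotProduct_compound_mulVec {g : Matrix (Fin 4) (Fin 4) ℝ} (hg : gᵀ * g = 1)
    (x y : Fin 6 → ℝ) : (compound g *ᵥ x) ⬝ᵥ (compound g *ᵥ y) = x ⬝ᵥ y := by
  rw [Matrix.dotProduct_mulVec, Matrix.vecMul_mulVec, compound_orthogonal hg, Matrix.vecMul_one]

/-- In particular the norm-squared `x ⬝ᵥ x` of a 2-form's coefficient vector is coframe-
independent. -/
theorem dotProduct_self_compound_mulVec {g : Matrix (Fin 4) (Fin 4) ℝ} (hg : gᵀ * g = 1)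
    (x : Fin 6 → ℝ) : (compound g *ᵥ x) ⬝ᵥ (compound g *ᵥ x) = x ⬝ᵥ x :=
  dotProduct_compound_mulVec hg x x

end Summit.Ventures.HodgeRepro2.T5CoframeInvariance
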